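import Summits.HubbardSuperconductivity.HubbardSuperconductivity.Theorems.AnisotropyChordTransferFibre3N1RowCheckSound

/-!
# Route `AnisotropyChord` / H0 rotor rung: the row-`N₁` cell checker on an ARBITRARY base box (adapter for the per-`L` FIN bridge)

p2's staged cell checker `…N1RowExprC.n1CellCheck c a₁ a₂ M₂ cmin (prec, iters)` and its interval-layer soundness
`…N1RowCheckSound.n1CellCheck_sound` take the sixteen-variable base box from an L-free certificate `c : L2.NamedCell`
(`c.box a₁ a₂`, `θ² ∈ [0, (2π/128)²]`).  The FIN range `L < L₀` supplies a DIFFERENT base box for the same variable vector —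
`FinCell.finBox L la lb a₁ a₂` / `FinCell.finBoxG L la lb` of `…Fibre3FinNamedCell` (named sums exact at this `L`, tight `θ²`).
THIS FILE is the forty-line adapter that lets both plug into the same program: the checker and its soundness restated for any
base box `B` of length `16`.
* `cellBoxB`, `cellFinalBoxB`, ★ `n1CellCheckB B M₂ cmin (prec, iters)` — `extendBox`/`encloseObjs`/`finalBox`/the three
  `rexprLeOn` claims, verbatim from `…N1RowExprC` with `c.box a₁ a₂ ↦ B`;
* `n1CellCheck_eq_checkB : n1CellCheck c a₁ a₂ … = n1CellCheckB (c.box a₁ a₂) …` (`rfl`: nothing diverges);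
* ★★ `n1CellCheckB_sound` — `…N1RowCheckSound.n1CellCheck_sound` with the hypothesis `PMem B X`, `B.length = 16`
  (same proof, same conclusions `1 ≤ P̂`, `1 ≤ U′(y)`, `cmin·U′(y) ≤ N₁′(y)` at `y = finalVec X vs`).
Prover seat `hubbard-h0-rotor-p3` g5; helper for piece A = stmt-HubbardSuperconductivity-23918 of rung 19089 (`--supports`, helper
class).  WHAT THIS IS NOT: nothing here proves superconductivity in the Hubbard model (rotor TARGET as worded stays FALSE, g15 verdict);
interval-layer plumbing for the FIN certificates of ONE conditional reduction.  Tree imports only; no sorry, no new axioms.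
-/

set_option linter.dupNamespace false
set_option autoImplicit false

open Literature.Analysis.ValidatedNumerics

namespace Summit.HubbardSuperconductivity.HubbardSuperconductivity.Theorems.AnisotropyChord.Transfer.Fibre3.L2.N1

/-! ## The checker on a base box -/

/-- the full staged box over a base box `B` (stage 1), if all enclosures succeed. -/
def cellBoxB (B : Box) (M2 : ℕ) (pi : ℕ × ℕ) : Option Box :=
  extendBox pi.1 pi.2 B (specs M2)

/-- the final box over a base box `B` (stages 1–2), if all enclosures succeed. -/
def cellFinalBoxB (B : Box) (M2 : ℕ) (pi : ℕ × ℕ) : Option Box :=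
  match cellBoxB B M2 pi with
  | none => none
  | some B' =>
    match encloseObjs pi.1 pi.2 B' (objSpecs M2) with
    | none => none
    | some objs => some (finalBox B' objs)

/-- ★ THE ROW-`N₁` CELL CHECK on a base box `B`: `P̂ ≥ 1`, `U′ ≥ 1` and `c₁″ = N₁′/U′ ≥ cmin`. -/
def n1CellCheckB (B : Box) (M2 : ℕ) (cmin : ℚ) (pi : ℕ × ℕ) : Bool :=
  match cellFinalBoxB B M2 pi with
  | none => false
  | some F => rexprLeOn (.neg fP) (-1) F pi && rexprLeOn (.neg UpE) (-1) F pi && rexprLeOn (marginE cmin) 0 F pi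

/-- p2's checker is the base-box checker on `c.box a₁ a₂`. [folklore] -/
theorem n1CellCheck_eq_checkB (c : L2.NamedCell) (a1 a2 : ℚ) (M2 : ℕ) (cmin : ℚ) (pi : ℕ × ℕ) :
    n1CellCheck c a1 a2 M2 cmin pi = n1CellCheckB (c.box a1 a2) M2 cmin pi := by
  unfold n1CellCheck n1CellCheckB cellFinalBox cellFinalBoxB cellBox cellBoxB
  rfl

/-! ## Soundness on a base box -/

/-- ★★ **SOUNDNESS OF `n1CellCheckB` (interval layer)** — `n1CellCheck_sound` for an arbitrary base box of length `16`:
if the check passes and the spec bookkeeping is fine, then for every real vector `X` prefix-in `B` whose staged coordinates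
satisfy the specs, and every list of five object values bracketed by the object specs at `X`, the final vector
`y = finalVec X vs` satisfies `1 ≤ y₆`, `1 ≤ U′(y)` and `cmin·U′(y) ≤ N₁′(y)`. [folklore] -/
theorem n1CellCheckB_sound (B : Box) (hB16 : B.length = 16) (M2 : ℕ) (cmin : ℚ) (pi : ℕ × ℕ)
    (h : n1CellCheckB B M2 cmin pi = true) (hv : specsVarsOk M2 = true) (X : ℕ → ℝ) (hX : PMem B X)
    (hsp : ∀ j (hj : j < (specs M2).length), ((specs M2)[j].1).eval X ≤ X (16 + j) ∧ X (16 + j) ≤ ((specs M2)[j].2).eval X)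
    (vs : List ℝ) (hvl : vs.length = 5)
    (hob : ∀ j (hj : j < (objSpecs M2).length) (hj' : j < vs.length),
      ((objSpecs M2)[j].1).eval X ≤ vs[j] ∧ vs[j] ≤ ((objSpecs M2)[j].2).eval X) :
    1 ≤ finalVec X vs 6 ∧ 1 ≤ UpE.eval (finalVec X vs) ∧
      (cmin : ℝ) * UpE.eval (finalVec X vs) ≤ N1pE.eval (finalVec X vs) := by
  simp only [specsVarsOk, Bool.and_eq_true] at hv
  obtain ⟨hv1, hv2⟩ := hv
  -- stage 1
  have hS : SpecsHold X B.length (specs M2) := by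
    rw [hB16]; exact specsHold_of X (specs M2) 16 hv1 hsp
  unfold n1CellCheckB cellFinalBoxB cellBoxB at h
  split at h
  · exact absurd h (by simp)
  · rename_i F hF
    split at hF
    · exact absurd hF (by simp)
    · rename_i B' hB'
      split at hF
      · exact absurd hF (by simp)
      · rename_i objs hobjs
        simp only [Option.some.injEq] at hF
        subst hF
        obtain ⟨hPB, hlenB⟩ := extendBox_sound pi.1 pi.2 X (specs M2) _ B' hB' hX hS
        -- stage 2
        have hO : ObjsHold X B'.length (objSpecs M2) vs := by
          rw [hlenB, hB16]
          exact objsHold_of X _ (objSpecs M2) vs (by rw [hvl]; simp [objSpecs]) hv2 hob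
        have hbr := encloseObjs_sound pi.1 pi.2 hPB (objSpecs M2) vs objs hobjs hO
        have hmem := finalBox_mem hPB (by
          rw [hlenB, hB16]
          simp only [specs, List.length_append, List.length_cons, List.length_nil, List.length_map]
          omega) hbr
        -- the three claims
        simp only [Bool.and_eq_true] at h
        obtain ⟨⟨hP, hU⟩, hM⟩ := h
        have eP := rexprLeOn_sound hP _ hmem
        have eU := rexprLeOn_sound hU _ hmem
        have eM := rexprLeOn_sound hM _ hmem
        simp only [RExpr.eval] at eP eU eM
        refine ⟨?_, ?_, ?_⟩
        · have : (((-1 : ℚ)) : ℝ) = -1 := by push_cast; ring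
          simp only [fP, RExpr.eval] at eP
          rw [this] at eP
          linarith
        · have : (((-1 : ℚ)) : ℝ) = -1 := by push_cast; ring
          rw [this] at eU
          linarith
        · simp only [marginE, RExpr.eval, cst] at eM
          have : (((0 : ℚ)) : ℝ) = 0 := by push_cast; ring
          rw [this] at eM
          linarith

end Summit.HubbardSuperconductivity.HubbardSuperconductivity.Theorems.AnisotropyChord.Transfer.Fibre3.L2.N1
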